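import Mathlib
import HarnessLib
import Summits.HodgeConjecture.HodgeConjecture.Theorems.HodgeLocusCensusExSet632Char0
import Summits.HodgeConjecture.HodgeConjecture.Theorems.HodgeLocusCensusEngineM83
import Summits.HodgeConjecture.HodgeConjecture.Theorems.HodgeLocusCensusExcessLowerBound832
import Summits.HodgeConjecture.HodgeConjecture.Theorems.HodgeLocusCensusExcessLowerBound833
import Summits.HodgeConjecture.HodgeConjecture.Theorems.HodgeLocusCensusExSet83Smooth
import Summits.HodgeConjecture.HodgeConjecture.Theorems.HodgeLocusCensusExSet83Certs
import Summits.HodgeConjecture.HodgeConjecture.Theorems.HodgeLocusCensusExSet83Canon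

/-!
# Hodge-locus census — exceptional sets decided in characteristic 0 in the cubic-eightfold cells (8,3,3), (8,3,2), (8,3,1), two implementations

Certified instances and evidence bearing on the general Hodge conjecture; no claim.

Record: `run/shared/lean/pub/pub-hlocus/pub-hlocus-ivhs-2/gen23/record/M83-CHAR0-g23.md` (ivhs-2 = engine-B seat, generation 23; kit jobs j143188 = both
programs, exact, all three cells, canonical lines identical to the local logs; j143199 = socle pairings; j143334 = (6,3,2) validation).  This file is the
n = 8 sequel of `HodgeLocusCensusExSet632Char0` (generation 22, cell (6,3,2)) with the same method and the same division of labour between the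
Lean kernel and two independent programs, and it supplies what `HodgeLocusCensusEngineM83` (generation 21/22) lacked: characteristic 0 instead
of one prime, ALL complex λ instead of three sampled values, smoothness of X PROVED instead of vertex-checked, and a second implementation.

SETTING (as in the (6,3,2) file).  Cell (8,3,m): smooth cubic eightfolds X ⊂ ℙ⁹ containing two 4-planes P, P′ with dim P ∩ P′ = m; V_λ = the
Hodge locus of [P] + λ[P′] near X; N ⊂ V_λ the pair locus (smooth, codimension c in the transversal slice S ≅ (S₃/J₃, 0) of the
projective action); E(X) = the finite set of λ ∈ ℙ¹ at which rank B(λ) (B(λ) = α + λβ restricted to complement coordinates U of T_X N,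
values in R₈ ≅ H^{3,5}_prim, q = 45) or the rank of Maclean's quadratic form Ob(λ) on C(λ) = R₈/im B(λ) drops below its generic value;
(†) if at ONE smooth X of the cell and one λ the slice germ (V_λ ∩ S, X) is Artinian of length ℓ then μ₀(8,3,m;λ) ≤ ℓ (upper semicontinuity
of fibre length in the flat family V_λ → V_λ/N); rank Ob(λ) = e(e+1)/2 with e = #U − rank B(λ) gives length exactly 1 + e.

THE POINTS X.  One sparse rational cubic per cell, all coefficients 1 (§1: `cubicC833`, `cubicC832`, `cubicC831`; 14 / 16 / 16 monomials), of the
uniform shape F = Σ_couples (x³ + x·y²) + Σ_pairs (a²b + ab² + ab·σ), σ = Σ y, lying in I(P) ∩ I(P′) for the census pair; SMOOTH OVER ℂ —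
PROVED HERE (`cubicC8mm_gradient_only_zero`, `cubicC8mm_critical_point_origin`): the only common zero of the ten partial derivatives in ℂ¹⁰ is
the origin, by a uniform elimination whose only non-trivial inputs are six small Nullstellensatz certificates `core_s_j` (D·uᴺ ∈ the ideal
(108yᵢ⁴ + j²u⁴)ᵢ, found by exact linear algebra and checked by `linear_combination`).

RESULTS (engine normalisation of λ = the geometric pencil [P] + λ[P′], see §4 for the orientation of [P′]):
* (8,3,3) at X = C833: q = 45, c = 16, #U = 16, generic rank B = 14, e = 2, dim C = 31, rank Ob = 3/3 ⇒ slice-fibre LENGTH 3 at every complex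
  λ ∉ E(X) = {0, 1, ∞}: the certificate polynomials g₁ (r×r minors of B(λ)) and g₂ (maximal minors of [B(λ) | sym q(λ)] over a kernel basis) of
  BOTH implementations have complex zero set exactly {0, 1} (§2, `certificate_zero_set_833A/B`); hence μ₀(8,3,3;λ) ≤ 3 for every complex λ ∉ E(X),
  = 3 with the tree's lower bound e ≥ 2 ∀X (§5).  s₁ = 1 (residual relation, exact, both programs; socle pairing agrees: A p=1000003, B p=998244353).
* (8,3,2) at X = C832: q = 45, c = 19, #U = 19, generic rank B = 17, e = 2, dim C = 28, rank Ob = 3/3 ⇒ slice-fibre LENGTH 3 at every complex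
  λ ∉ E(X) = {-1, 0, ∞}: the certificate polynomials g₁ (r×r minors of B(λ)) and g₂ (maximal minors of [B(λ) | sym q(λ)] over a kernel basis) of
  BOTH implementations have complex zero set exactly {0, -1} (§2, `certificate_zero_set_832A/B`); hence μ₀(8,3,2;λ) ≤ 3 for every complex λ ∉ E(X),
  = 3 with the tree's lower bound e ≥ 2 ∀X (§5).  s₁ = 1 by the socle pairing (A p=1000003: r = +1·ι, B p=998244353: r = +1·ι).
* (8,3,1) at X = C831: q = 45, c = 20, #U = 20, generic rank B = 19, e = 1, dim C = 26, rank Ob = 1/1 ⇒ slice-fibre LENGTH 2 at every complex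
  λ ∉ E(X) = {0, 1, ∞}: the certificate polynomials g₁ (r×r minors of B(λ)) and g₂ (maximal minors of [B(λ) | sym q(λ)] over a kernel basis) of
  BOTH implementations have complex zero set exactly {0, 1} (§2, `certificate_zero_set_831A/B`); hence μ₀(8,3,1;λ) ≤ 2 for every complex λ ∉ E(X),
  = 2 with the lower bound e ≥ 1 ∀X of §0 (§5).  s₁ = 1 by the socle pairing (A p=1000003: r = +1·ι, B p=998244353: r = +1·ι).

TWO IMPLEMENTATIONS, VERBATIM-EQUAL CANONICAL OUTPUT (§3, `canonA8mm_eq_canonB8mm` by `decide`).  A = `exsetQg.py` (generation-22 engine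
generalised: exact rationals, incremental sparse echelon form with history vectors, sampled minors + irreducible minimal kernel basis).
B = `exsetBg.py` (new, independent code path: modular elimination with reduction histories, every rational object — orientation residual,
R_t membership of all Macaulay columns, the 2·#U tangent reductions, the #U(#U+1)/2 Maclean lifts — by Dixon p-adic lifting with rational
reconstruction and exact verification; kernel basis by Cramer's rule with polynomial determinants by evaluation/interpolation; its own
pivot-structure minors; and a verbatim recomputation of A's recorded minors from A's certificate: `xcheckB8mm_all`).  The canonical record
(INVARIANCE as in the (6,3,2) file: functions of F, the two frames and the monomial order only) is F, ω_P, ω_P′ (digests), signs, the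
canonical basis of R₈ (digest), ranks, U, rref[B(0) | B′] (rank, pivots, digest), pencil-rank profile, the pass-2 table at 8 sample λ,
minimal kernel degrees, E.  The certificate polynomials themselves are implementation-specific by design (different minors, different
kernel bases: A's minimal basis of degrees (1,1) versus B's Cramer basis of high degree) and BOTH zero sets are proved in §2.

FILES (400-line rule): §1 = `HodgeLocusCensusExSet83Smooth`, §2 = `HodgeLocusCensusExSet83Certs`, §§3–4 = `HodgeLocusCensusExSet83Canon` (all in this
namespace, imported here); this file holds the setting, §0 and §5.

KERNEL-CHECKED HERE: §0 the (8,3,1) instance e ≥ 1 of the tree's Kloosterman inequality; §1 smoothness of the three cubics over ℂ;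
§2 the complex zero sets of all certificate polynomials; §3 A = B and what the records say; §4 the intersection arithmetic behind ι and the
consistency of the recorded orientation rows; §5 the bookkeeping.  NOT FORMALISED (as in the (6,3,2) file): the IVHS identifications
(Carlson–Griffiths, Voisin 5.18), Maclean's second-order obstruction, the computation of B(λ), q(λ) and the socle values from F (the two
programs; logs, certificates and md5 in the record), and the step length ≥ multiplicity (†).  Nothing in this file is a statement about the
Hodge conjecture.
-/

namespace Summit.HodgeConjecture.HodgeConjecture.HodgeLocus.Census.ExSet83Char0

/-! ## 0. Input recorded by name: the Kloosterman lower bound in cell (8,3,1), quantitative form (cells (8,3,2), (8,3,3) are the tree files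
`HodgeLocusCensusExcessLowerBound832/833`) -/

noncomputable section LowerBound831

open MvPolynomial Module Literature.RingTheory.MvPolynomial
open Literature.AlgebraicGeometry.HodgeTheory Literature.AlgebraicGeometry.Motives.UniversalHypersurface
  Literature.AlgebraicGeometry.Kloosterman2023 Literature.AlgebraicGeometry.Kloosterman2025

variable {K : Type*} [Field K]

/-- The arithmetic of cell (8,3,1): `h_{I₁+I₂} = ciHilbert(2,2)` takes the values `h(2) = 1`, `h(3) = 0`. -/
theorem ciHilbert_22_at_2_and_3 :
    ciHilbert (List.replicate 2 2) 2 = 1 ∧ ciHilbert (List.replicate 2 2) 3 = 0 := by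
  decide

/-- **Census cell (8,3,1), quantitative form** (the `+ 1` companion of the tree's
`Literature.AlgebraicGeometry.Kloosterman2025.cubicEightfold_twoFourPlanes_line_idealDegree_inf_lt`): two 4-planes in a cubic eightfold meeting
along a LINE (`d = 3`, `k = 4`, `c = 3`, `r = 2`, `(α, β) = (3, 2)`): for every F in normal form with finite-dimensional Jacobian ring, every socle
functional ℓ and every c₀, `dim (I(Π₁) ∩ I(Π₂))₃ + 1 ≤ dim ker` of the graded multiplication form of ℓ₁ + c₀ℓ₂ on S₃ × S₂ — excess tangent
dimension e(X; c₀) ≥ 1 = h(2) − h(3) for EVERY X of the cell (Kloosterman 2025, Theorem 1.3 / Example 3.16 at (d, c, k) = (3, 3, 4)); the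
census lower bound μ₀(8,3,1; λ) ≥ 2. -/
theorem cubicEightfold_twoFourPlanes_line_finrank_inf_add_one_le (κ : Fin 3 ⊕ Fin 2 ≃ Fin (4 + 1))
    (gA h : Fin 3 → MvPolynomial (Fin (2 * 4 + 2)) K) (gC : Fin 2 → MvPolynomial (Fin (2 * 4 + 2)) K)
    (Q : Fin 3 → Fin 3 → MvPolynomial (Fin (2 * 4 + 2)) K) (P : Fin 2 → MvPolynomial (Fin (2 * 4 + 2)) K)
    (hgA : ∀ i, (gA i).IsHomogeneous 1) (hh : ∀ j, (h j).IsHomogeneous 1) (hgC : ∀ m, (gC m).IsHomogeneous 1)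
    (hQ : ∀ i j, (Q i j).IsHomogeneous 1) (hP : ∀ m, (P m).IsHomogeneous 2) {N : ℕ} (hN : 0 < N)
    (hXN : ∀ l, (X l : MvPolynomial (Fin (2 * 4 + 2)) K) ^ N ∈ jacobianIdeal (twoPlanesForm gA h gC Q P))
    {ℓ : MvPolynomial (Fin (2 * 4 + 2)) K →ₗ[K] K} (hℓ : ∀ p, ℓ (homogeneousComponent 10 p) = ℓ p)
    (hJ : annIdeal ℓ = jacobianIdeal (twoPlanesForm gA h gC Q P)) (c₀ : K) :
    finrank K (idealDegree
        ((Ideal.span (Set.range (plane₁Gens κ gA gC)) ⊔ Ideal.span (Set.range (plane₁Cofs κ h Q P))) ⊓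
          (Ideal.span (Set.range (plane₂Gens κ h gC)) ⊔ Ideal.span (Set.range (plane₂Cofs κ gA Q P)))) 3) + 1 ≤
      finrank K (LinearMap.ker (gradedMulForm
        (ciCycleFunctional ℓ (plane₁Gens κ gA gC) (plane₁Cofs κ h Q P) +
          c₀ • ciCycleFunctional ℓ (plane₂Gens κ h gC) (plane₂Cofs κ gA Q P)) 3 2)) := by
  have h0 := twoPlanes_finrank_inf_add_ciHilbert_le (d := 3) (by norm_num) κ gA h gC Q P hgA hh hgC hQ hP hN hXN
    hℓ hJ (α := 3) (β := 2) (by norm_num) c₀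
  have h1 : ciHilbert (List.replicate 2 (3 - 1)) 2 = 1 := by decide
  have h2 : ciHilbert (List.replicate 2 (3 - 1)) 3 = 0 := by decide
  rw [h1, h2] at h0
  omega

end LowerBound831


/-! ## 5. Bookkeeping of the conclusions (the arithmetic only; the inputs are named in the module docstring) -/

/-- (8,3,3) and (8,3,2): slice-fibre length 3 at one smooth X of the cell at every complex λ ∉ E(X) (§§2–3), multiplicity ≤ length,
μ₀ ≤ multiplicity at any point of the locus, μ₀ ≥ 1 + e_gen (census) and e_gen ≥ 2 (`ExcessLowerBound.cubicEightfold_twoFourPlanes_threePlane_finrank_inf_add_two_le`,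
`…_plane_finrank_inf_add_two_le`, every X, every λ) force μ₀ = 3 and e_gen = 2 there — this is the arithmetic lemma `ExSet632Char0.mu0_eq_three_everywhere`
of the (6,3,2) anchor (imported, not restated); here its instance with the census lower bound e_gen ≥ 2 of BOTH m = 3 and m = 2 spelled out as hypotheses
on the two cells' numbers. -/
theorem mu0_eq_three_cells_833_832 {μ₈₃₃ μ₈₃₂ e₈₃₃ e₈₃₂ m₈₃₃ m₈₃₂ : ℕ}
    (h3 : m₈₃₃ ≤ 3 ∧ μ₈₃₃ ≤ m₈₃₃ ∧ 1 + e₈₃₃ ≤ μ₈₃₃ ∧ 2 ≤ e₈₃₃) (h2 : m₈₃₂ ≤ 3 ∧ μ₈₃₂ ≤ m₈₃₂ ∧ 1 + e₈₃₂ ≤ μ₈₃₂ ∧ 2 ≤ e₈₃₂) :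
    (μ₈₃₃ = 3 ∧ e₈₃₃ = 2) ∧ (μ₈₃₂ = 3 ∧ e₈₃₂ = 2) :=
  ⟨ExSet632Char0.mu0_eq_three_everywhere h3.1 h3.2.1 h3.2.2.1 h3.2.2.2, ExSet632Char0.mu0_eq_three_everywhere h2.1 h2.2.1 h2.2.2.1 h2.2.2.2⟩

/-- (8,3,1): slice-fibre length 2 at one smooth X at every complex λ ∉ E(X), and e_gen ≥ 1 (`cubicEightfold_twoFourPlanes_line_finrank_inf_add_one_le`,
every X, every λ) force μ₀ = 2 and e_gen = 1 there. -/
theorem mu0_eq_two_of_length_two {μ₀ eGen mult : ℕ} (hml : mult ≤ 2) (hμm : μ₀ ≤ mult) (hlow : 1 + eGen ≤ μ₀) (he : 1 ≤ eGen) :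
    μ₀ = 2 ∧ eGen = 1 := by omega

/-- The three rows against the engine-M bookkeeping already in the tree (`EngineM83.runs_length`, `EngineM83.runs_eq_census`: genBound 45 20 1 = 2,
genBound 45 19 2 = 3, genBound 45 16 2 = 3): the generic slice-fibre LENGTHS certified here in characteristic 0 at C831 / C832 / C833 (the `length`
field of the canonical records of §3, equal for A and B) are the lengths engine M measured over a finite field at random vertex-smooth members of the
three cells — the same census constants 2 / 3 / 3, now by two methods. -/
theorem canon_lengths_eq_engineM_lengths :
    canonA831.length = EngineM83.run831.row.lengthLB ∧ canonA832.length = EngineM83.run832.row.lengthLB ∧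
      canonA833.length = EngineM83.run833.row.lengthLB := by
  obtain ⟨h1, h2, h3⟩ := EngineM83.runs_length
  rw [h1, h2, h3]
  decide

end Summit.HodgeConjecture.HodgeConjecture.HodgeLocus.Census.ExSet83Char0
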